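import Literature.MathematicalPhysics.QuantumFieldTheory.Balaban1983to89.StrongCouplingTorusWindow
import HarnessLib

/-!
# Robust ball (Y2) — the AXIS OFFSET MULTISET of the TORUS link graph (doubled cyclic coordinate) and the axis supersolution inequality
# for the torus influence count `tInfluence`

HONEST FRAMING: venture file of the cell `pub-ymgap` (QuantumFields programme), track ROBUST-BALL, seat rb-p2 (g10).  Pure lattice combinatorics on the
torus `(ℤ/L)^d` (no measure theory), the torus twin of `ZdAxisProfile`: for a link `e = (x, μ)` and an axis `i` put
`H_i(y) = 2·val(y_i) + [dir y = i] ∈ ℤ/2L` (twice the `i`-coordinate of the midpoint, read cyclically).  Over the staple links of the plaquettes through `e`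
(the support of Dobrushin's torus influence count `tInfluence e ·`, `StrongCouplingTorusWindow`) the offsets `H_i(staple) − H_i(e)` are `{+1, 0, −1}` per
plaquette when `μ = i`, and `{+2,+1,+1}` / `{−2,−1,−1}` for the two plaquettes of the plane `(μ, i)` plus `{0,0,0}` otherwise when `μ ≠ i`
(`sum_profile_tstapleLinks_eq`).  For a profile `G ≥ 0` on `ℤ/2L` with `G(k+1)+G(k−1) ≤ (θ+θ⁻¹)G(k)` and `G(k+2)+G(k−2) ≤ (θ²+θ⁻²)G(k)` this gives
`∑_{q ∋ e} ∑_k G(H_i(staple_k)) ≤ P(e)·G(H_i(e))` with `P = 2(d−1)(θ+θ⁻¹+1)` (`μ = i`) resp. `θ⁻²+2θ⁻¹+2θ+θ²+6(d−2)` (`μ ≠ i`)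
(`sum_profile_plaqsThrough_le`) and the supersolution inequality `∑_y tInfluence e y · G(H_i y) ≤ P(e) · G(H_i e)` (`sum_tInfluence_mul_le_axis`) — the input of an
axis-rate clustering bound for torus members (successor file).  `L ≥ 2`.  Nothing about the continuum or Clay.
-/

noncomputable section

open Finset Function
open Literature.MathematicalPhysics.QuantumFieldTheory
open Literature.MathematicalPhysics.QuantumFieldTheory.Balaban1983to89.StrongCouplingTorusWindow

namespace Summit.Ventures.YMGap.RobustBall.TorusAxis

variable {d L : ℕ} [NeZero L]

/-! ### The doubled cyclic coordinate -/

/-- Doubling `ℤ/L → ℤ/2L` on representatives commutes with `+1`: `2·val(a+1) ≡ 2·val(a) + 2 (mod 2L)`. [folklore] -/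
theorem cast_two_mul_val_add_one (hL : 2 ≤ L) (a : ZMod L) :
    ((2 * (a + 1).val : ℕ) : ZMod (2 * L)) = ((2 * a.val : ℕ) : ZMod (2 * L)) + 2 := by
  haveI : Fact (1 < L) := ⟨by omega⟩
  rw [ZMod.val_add, ZMod.val_one, ← Nat.mul_mod_mul_left, ZMod.natCast_mod]
  push_cast; ring

/-- The doubled cyclic `i`-coordinate of the midpoint of a link, `H_i(x, λ) = 2·val(x_i) + [λ = i] ∈ ℤ/2L`. (Inline; this lemma evaluates it on a
shifted base point: `H_i(x + e_j, λ) = H_i-part(x) + 2[j = i] + [λ = i]`.) [folklore] -/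
theorem hc_shift (hL : 2 ≤ L) (x : Site d L) (j i : Fin d) (lam : Fin d) :
    (((2 * ((x.shift j) i).val : ℕ) : ZMod (2 * L)) + (if lam = i then 1 else 0)) =
      ((2 * (x i).val : ℕ) : ZMod (2 * L)) + (if j = i then 2 else 0) + (if lam = i then 1 else 0) := by
  by_cases hji : j = i
  · subst hji
    have : (x.shift j) j = x j + 1 := by simp [Site.shift]
    rw [this, cast_two_mul_val_add_one hL, if_pos rfl]
  · have : (x.shift j) i = x i := by simp [Site.shift, Ne.symm hji]
    rw [this, if_neg hji, add_zero]

/-! ### The per-plaquette offset sums -/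

/-- The sum of a function over the three torus staple links of `q` at a link `e ∈ q` (`L ≥ 2`: the four links are distinct). [folklore] -/
theorem sum_tstapleLinks_eq (hL : 1 < L) (q : Plaquette d L) {e : Edge d L} (he : e ∈ plaqEdgesT q) (f : Edge d L → ℝ) :
    ∑ k : Fin 3, f (tstapleLinks q e k) = f (tLink1 q) + f (tLink2 q) + f (tLink3 q) + f (tLink4 q) - f e := by
  have h12 := tLink1_ne_tLink2 q
  have h13 := tLink1_ne_tLink3 hL q
  have h14 := tLink1_ne_tLink4 q
  have h23 := tLink2_ne_tLink3 q
  have h24 := tLink2_ne_tLink4 hL q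
  have h34 := tLink3_ne_tLink4 q
  rw [plaqEdgesT_eq] at he
  simp only [Finset.mem_insert, Finset.mem_singleton] at he
  rcases he with rfl | rfl | rfl | rfl
  · simp [tstapleLinks, Fin.sum_univ_three]; ring
  · simp [tstapleLinks, h12.symm, Fin.sum_univ_three]; ring
  · simp [tstapleLinks, h13.symm, h23.symm, Fin.sum_univ_three]; ring
  · simp [tstapleLinks, h14.symm, h24.symm, h34.symm, Fin.sum_univ_three]; ring

/-- **Per-plaquette offsets on the torus.**  For a profile `G : ℤ/2L → ℝ`, a plaquette `q = (z, j < k')` through `e = (x, μ)` and an axis `i`, with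
`K = H_i(e)`: `∑_k G(H_i(staple_k)) = G(K+1)+G(K)+G(K−1)` if `μ = i`; if `μ ≠ i` and the other direction of `q` is `i`:
`2G(K+1)+G(K+2)` (side `+`, `q` based at `x`) or `2G(K−1)+G(K−2)` (side `−`); and `3G(K)` if the plane of `q` avoids `i`. [folklore] -/
theorem sum_profile_tstapleLinks_eq (hL : 2 ≤ L) (G : ZMod (2 * L) → ℝ) (q : Plaquette d L) {e : Edge d L} (he : e ∈ plaqEdgesT q)
    (i : Fin d) :
    ∑ k : Fin 3, G (((2 * ((tstapleLinks q e k).1 i).val : ℕ) : ZMod (2 * L)) + (if (tstapleLinks q e k).2 = i then 1 else 0)) =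
      if e.2 = i then
        G (((2 * (e.1 i).val : ℕ) : ZMod (2 * L)) + (if e.2 = i then 1 else 0) + 1) +
          G (((2 * (e.1 i).val : ℕ) : ZMod (2 * L)) + (if e.2 = i then 1 else 0)) +
          G (((2 * (e.1 i).val : ℕ) : ZMod (2 * L)) + (if e.2 = i then 1 else 0) - 1)
      else if (if q.2.1.1 = e.2 then q.2.1.2 else q.2.1.1) = i then
        (if q.1 = e.1 then
          2 * G (((2 * (e.1 i).val : ℕ) : ZMod (2 * L)) + (if e.2 = i then 1 else 0) + 1) +
            G (((2 * (e.1 i).val : ℕ) : ZMod (2 * L)) + (if e.2 = i then 1 else 0) + 2)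
        else
          2 * G (((2 * (e.1 i).val : ℕ) : ZMod (2 * L)) + (if e.2 = i then 1 else 0) - 1) +
            G (((2 * (e.1 i).val : ℕ) : ZMod (2 * L)) + (if e.2 = i then 1 else 0) - 2))
      else 3 * G (((2 * (e.1 i).val : ℕ) : ZMod (2 * L)) + (if e.2 = i then 1 else 0)) := by
  have hL1 : 1 < L := by omega
  have hjk : q.2.1.1 ≠ q.2.1.2 := (q.2.2).ne
  set Hc : Edge d L → ZMod (2 * L) := fun y => ((2 * (y.1 i).val : ℕ) : ZMod (2 * L)) + (if y.2 = i then 1 else 0) with hHc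
  set B : ZMod (2 * L) := ((2 * (q.1 i).val : ℕ) : ZMod (2 * L)) with hB
  have v1 : Hc (tLink1 q) = B + (if q.2.1.1 = i then 1 else 0) := by simp [hHc, hB, tLink1]
  have v2 : Hc (tLink2 q) = B + (if q.2.1.1 = i then 2 else 0) + (if q.2.1.2 = i then 1 else 0) := by
    simp only [hHc, hB, tLink2]; exact hc_shift hL q.1 _ i _
  have v3 : Hc (tLink3 q) = B + (if q.2.1.2 = i then 2 else 0) + (if q.2.1.1 = i then 1 else 0) := by
    simp only [hHc, hB, tLink3]; exact hc_shift hL q.1 _ i _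
  have v4 : Hc (tLink4 q) = B + (if q.2.1.2 = i then 1 else 0) := by simp [hHc, hB, tLink4]
  have hsum := sum_tstapleLinks_eq hL1 q he (fun y => G (Hc y))
  change ∑ k : Fin 3, G (Hc (tstapleLinks q e k)) = _
  rw [hsum]
  have hne2 : q.1.shift q.2.1.1 ≠ q.1 := shift_ne_self hL1 q.1 _
  have hne3 : q.1.shift q.2.1.2 ≠ q.1 := shift_ne_self hL1 q.1 _
  rw [plaqEdgesT_eq] at he
  simp only [Finset.mem_insert, Finset.mem_singleton] at he
  rcases he with rfl | rfl | rfl | rfl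
  · -- `e = (z, j)`: side `+`, other direction `k'`
    change G (Hc (tLink1 q)) + G (Hc (tLink2 q)) + G (Hc (tLink3 q)) + G (Hc (tLink4 q)) - G (Hc (tLink1 q)) =
      if (tLink1 q).2 = i then G (Hc (tLink1 q) + 1) + G (Hc (tLink1 q)) + G (Hc (tLink1 q) - 1)
      else if (if q.2.1.1 = (tLink1 q).2 then q.2.1.2 else q.2.1.1) = i then
        (if q.1 = (tLink1 q).1 then 2 * G (Hc (tLink1 q) + 1) + G (Hc (tLink1 q) + 2)
          else 2 * G (Hc (tLink1 q) - 1) + G (Hc (tLink1 q) - 2))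
      else 3 * G (Hc (tLink1 q))
    rw [v1, v2, v3, v4]
    simp only [tLink1, if_true]
    by_cases hj : q.2.1.1 = i
    · have hk : q.2.1.2 ≠ i := fun h => hjk (hj.trans h.symm)
      simp [hj, hk]; ring_nf
    · by_cases hk : q.2.1.2 = i
      · simp [hj, hk]; ring_nf
      · simp [hj, hk]; ring
  · -- `e = (z + e_j, k')`: side `−`, other direction `j`
    change G (Hc (tLink1 q)) + G (Hc (tLink2 q)) + G (Hc (tLink3 q)) + G (Hc (tLink4 q)) - G (Hc (tLink2 q)) =
      if (tLink2 q).2 = i then G (Hc (tLink2 q) + 1) + G (Hc (tLink2 q)) + G (Hc (tLink2 q) - 1)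
      else if (if q.2.1.1 = (tLink2 q).2 then q.2.1.2 else q.2.1.1) = i then
        (if q.1 = (tLink2 q).1 then 2 * G (Hc (tLink2 q) + 1) + G (Hc (tLink2 q) + 2)
          else 2 * G (Hc (tLink2 q) - 1) + G (Hc (tLink2 q) - 2))
      else 3 * G (Hc (tLink2 q))
    rw [v1, v2, v3, v4]
    simp only [tLink2, hjk, if_false, hne2.symm]
    by_cases hk : q.2.1.2 = i
    · have hj : q.2.1.1 ≠ i := fun h => hjk (h.trans hk.symm)
      simp [hj, hk]; ring_nf
    · by_cases hj : q.2.1.1 = i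
      · simp [hj, hk]; ring_nf
      · simp [hj, hk]; ring
  · -- `e = (z + e_k', j)`: side `−`, other direction `k'`
    change G (Hc (tLink1 q)) + G (Hc (tLink2 q)) + G (Hc (tLink3 q)) + G (Hc (tLink4 q)) - G (Hc (tLink3 q)) =
      if (tLink3 q).2 = i then G (Hc (tLink3 q) + 1) + G (Hc (tLink3 q)) + G (Hc (tLink3 q) - 1)
      else if (if q.2.1.1 = (tLink3 q).2 then q.2.1.2 else q.2.1.1) = i then
        (if q.1 = (tLink3 q).1 then 2 * G (Hc (tLink3 q) + 1) + G (Hc (tLink3 q) + 2)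
          else 2 * G (Hc (tLink3 q) - 1) + G (Hc (tLink3 q) - 2))
      else 3 * G (Hc (tLink3 q))
    rw [v1, v2, v3, v4]
    simp only [tLink3, if_true, hne3.symm, if_false]
    by_cases hj : q.2.1.1 = i
    · have hk : q.2.1.2 ≠ i := fun h => hjk (hj.trans h.symm)
      simp [hj, hk]; ring_nf
    · by_cases hk : q.2.1.2 = i
      · simp [hj, hk]; ring_nf
      · simp [hj, hk]; ring
  · -- `e = (z, k')`: side `+`, other direction `j`
    change G (Hc (tLink1 q)) + G (Hc (tLink2 q)) + G (Hc (tLink3 q)) + G (Hc (tLink4 q)) - G (Hc (tLink4 q)) =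
      if (tLink4 q).2 = i then G (Hc (tLink4 q) + 1) + G (Hc (tLink4 q)) + G (Hc (tLink4 q) - 1)
      else if (if q.2.1.1 = (tLink4 q).2 then q.2.1.2 else q.2.1.1) = i then
        (if q.1 = (tLink4 q).1 then 2 * G (Hc (tLink4 q) + 1) + G (Hc (tLink4 q) + 2)
          else 2 * G (Hc (tLink4 q) - 1) + G (Hc (tLink4 q) - 2))
      else 3 * G (Hc (tLink4 q))
    rw [v1, v2, v3, v4]
    simp only [tLink4, if_true, hjk, if_false]
    by_cases hk : q.2.1.2 = i
    · have hj : q.2.1.1 ≠ i := fun h => hjk (h.trans hk.symm)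
      simp [hj, hk]; ring_nf
    · by_cases hj : q.2.1.1 = i
      · simp [hj, hk]; ring_nf
      · simp [hj, hk]; ring


/-! ### Summing over the plaquettes through `e` -/

omit [NeZero L] in
/-- A plaquette through `e` is determined by its other direction and its side (torus twin of `plaqRecover_eq`). [folklore] -/
theorem plaq_eq_of_otherDir_side {e : Edge d L} {q q' : Plaquette d L} (hq : e ∈ plaqEdgesT q) (hq' : e ∈ plaqEdgesT q')
    (hdir : (if q.2.1.1 = e.2 then q.2.1.2 else q.2.1.1) = (if q'.2.1.1 = e.2 then q'.2.1.2 else q'.2.1.1))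
    (hside : decide (q.1 = e.1) = decide (q'.1 = e.1)) : q = q' := by
  -- both reconstruct to the same `(base point, direction pair)`
  have key : ∀ {p : Plaquette d L}, e ∈ plaqEdgesT p →
      (p.1, p.2.1) = (if decide (p.1 = e.1) then e.1 else e.1 - Pi.single (if p.2.1.1 = e.2 then p.2.1.2 else p.2.1.1) 1,
        (min e.2 (if p.2.1.1 = e.2 then p.2.1.2 else p.2.1.1), max e.2 (if p.2.1.1 = e.2 then p.2.1.2 else p.2.1.1))) := by
    intro p hp
    have hij : p.2.1.1 < p.2.1.2 := p.2.2
    have hne : p.2.1.1 ≠ p.2.1.2 := hij.ne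
    rw [plaqEdgesT_eq] at hp
    simp only [tLink1, tLink2, tLink3, tLink4, Finset.mem_insert, Finset.mem_singleton] at hp
    rcases hp with rfl | rfl | rfl | rfl
    · simp [min_eq_left hij.le, max_eq_right hij.le]
    · simp [hne, Site.shift, min_eq_right hij.le, max_eq_left hij.le]
    · simp [Site.shift, min_eq_left hij.le, max_eq_right hij.le]
    · simp [hne, min_eq_right hij.le, max_eq_left hij.le]
  have h1 := key hq
  have h2 := key hq'
  rw [hdir, hside] at h1
  have h12 : (q.1, q.2.1) = (q'.1, q'.2.1) := h1.trans h2.symm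
  obtain ⟨hfst, hsnd⟩ := Prod.mk.inj h12
  exact Prod.ext hfst (Subtype.ext hsnd)

omit [NeZero L] in
/-- The other direction of a plaquette through `e` differs from the direction of `e`. [folklore] -/
theorem otherDir_ne {e : Edge d L} {q : Plaquette d L} (hq : e ∈ plaqEdgesT q) :
    (if q.2.1.1 = e.2 then q.2.1.2 else q.2.1.1) ≠ e.2 := by
  have hne : q.2.1.1 ≠ q.2.1.2 := (q.2.2).ne
  rw [plaqEdgesT_eq] at hq
  simp only [tLink1, tLink2, tLink3, tLink4, Finset.mem_insert, Finset.mem_singleton] at hq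
  split_ifs with h
  · exact fun h' => hne (h.trans h'.symm)
  · rcases hq with rfl | rfl | rfl | rfl <;> simp_all

/-- **THE TORUS AXIS OFFSET BOUND.**  For `d ≥ 2`, `L ≥ 2`, a link `e = (x, μ)`, an axis `i`, a real `θ ≠ 0` and a profile `G ≥ 0` on `ℤ/2L` with
`G(k+1) + G(k−1) ≤ (θ+θ⁻¹)G(k)` and `G(k+2) + G(k−2) ≤ (θ²+θ⁻²)G(k)` for all `k`:
`∑_{q ∋ e} ∑_k G(H_i(staple_k(q))) ≤ P·G(H_i(e))` with `P = 2(d−1)(θ+θ⁻¹+1)` if `μ = i` and `θ⁻²+2θ⁻¹+2θ+θ²+6(d−2)` if `μ ≠ i`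
(the two plaquettes of the plane `(μ,i)` are paired through the second-difference inequality). [folklore] -/
theorem sum_profile_plaqsThrough_le (hd : 2 ≤ d) (hL : 2 ≤ L) {θ : ℝ} {G : ZMod (2 * L) → ℝ} (hG0 : ∀ k, 0 ≤ G k)
    (hG1 : ∀ k, G (k + 1) + G (k - 1) ≤ (θ + θ⁻¹) * G k) (hG2 : ∀ k, G (k + 2) + G (k - 2) ≤ (θ ^ 2 + θ⁻¹ ^ 2) * G k)
    (e : Edge d L) (i : Fin d) :
    ∑ q ∈ plaqsThrough e, ∑ k : Fin 3,
        G (((2 * ((tstapleLinks q e k).1 i).val : ℕ) : ZMod (2 * L)) + (if (tstapleLinks q e k).2 = i then 1 else 0)) ≤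
      (if e.2 = i then 2 * ((d - 1 : ℕ) : ℝ) * (θ + θ⁻¹ + 1)
        else θ⁻¹ ^ 2 + 2 * θ⁻¹ + 2 * θ + θ ^ 2 + 6 * ((d - 2 : ℕ) : ℝ)) *
        G (((2 * (e.1 i).val : ℕ) : ZMod (2 * L)) + (if e.2 = i then 1 else 0)) := by
  classical
  have hL1 : 1 < L := by omega
  set K : ZMod (2 * L) := ((2 * (e.1 i).val : ℕ) : ZMod (2 * L)) + (if e.2 = i then 1 else 0) with hK
  -- the per-plaquette value as a function of (other direction, side)
  set T' : Fin d × Bool → ℝ := fun p =>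
    if e.2 = i then G (K + 1) + G K + G (K - 1)
    else if p.1 = i then (if p.2 then 2 * G (K + 1) + G (K + 2) else 2 * G (K - 1) + G (K - 2)) else 3 * G K with hT'
  have hT'0 : ∀ p, 0 ≤ T' p := by
    intro p; simp only [hT']
    have := hG0 (K + 1); have := hG0 K; have := hG0 (K - 1); have := hG0 (K + 2); have := hG0 (K - 2)
    split_ifs <;> linarith
  set g : Plaquette d L → Fin d × Bool := fun q => ((if q.2.1.1 = e.2 then q.2.1.2 else q.2.1.1), decide (q.1 = e.1)) with hg
  have hterm : ∀ q ∈ plaqsThrough e, ∑ k : Fin 3,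
      G (((2 * ((tstapleLinks q e k).1 i).val : ℕ) : ZMod (2 * L)) + (if (tstapleLinks q e k).2 = i then 1 else 0)) = T' (g q) := by
    intro q hq
    rw [sum_profile_tstapleLinks_eq hL G q (mem_plaqsThrough.1 hq) i]
    simp only [hT', hg, hK, decide_eq_true_eq]
  rw [Finset.sum_congr rfl hterm]
  have hinj : Set.InjOn g ↑(plaqsThrough e) := by
    intro q hq q' hq' h
    simp only [hg, Prod.mk.injEq] at h
    exact plaq_eq_of_otherDir_side (mem_plaqsThrough.1 (Finset.mem_coe.1 hq)) (mem_plaqsThrough.1 (Finset.mem_coe.1 hq')) h.1 h.2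
  have hmaps : (plaqsThrough e).image g ⊆ (Finset.univ.erase e.2) ×ˢ (Finset.univ : Finset Bool) := by
    intro p hp
    obtain ⟨q, hq, rfl⟩ := Finset.mem_image.1 hp
    exact Finset.mem_product.2 ⟨Finset.mem_erase.2 ⟨otherDir_ne (mem_plaqsThrough.1 hq), Finset.mem_univ _⟩, Finset.mem_univ _⟩
  calc ∑ q ∈ plaqsThrough e, T' (g q)
      = ∑ p ∈ (plaqsThrough e).image g, T' p := (Finset.sum_image hinj).symm
    _ ≤ ∑ p ∈ (Finset.univ.erase e.2) ×ˢ (Finset.univ : Finset Bool), T' p :=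
        Finset.sum_le_sum_of_subset_of_nonneg hmaps fun p _ _ => hT'0 p
    _ ≤ _ := by
        by_cases hμ : e.2 = i
        · simp only [hT', hμ, if_true, Finset.sum_const, Finset.card_product, Finset.card_erase_of_mem (Finset.mem_univ _),
            Finset.card_univ, Fintype.card_fin, Fintype.card_bool, nsmul_eq_mul]
          have h1 := hG1 K
          have hGK := hG0 K
          push_cast [Nat.cast_sub (by omega : 1 ≤ d)]
          have hd2 : (2 : ℝ) ≤ d := by exact_mod_cast hd
          have hd0 : (0 : ℝ) ≤ (d : ℝ) - 1 := by linarith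
          nlinarith
        · rw [Finset.sum_product]
          have hi : i ∈ Finset.univ.erase e.2 := Finset.mem_erase.2 ⟨Ne.symm hμ, Finset.mem_univ _⟩
          rw [← Finset.add_sum_erase _ _ hi]
          have hfirst : ∑ b : Bool, T' (i, b) = 2 * (G (K + 1) + G (K - 1)) + (G (K + 2) + G (K - 2)) := by
            simp [hT', hμ]; ring
          have hrest : ∀ ν ∈ (Finset.univ.erase e.2).erase i, ∑ b : Bool, T' (ν, b) = 6 * G K := by
            intro ν hν
            have hνi : ν ≠ i := (Finset.mem_erase.1 hν).1
            simp [hT', hμ, hνi]; ring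
          have hcard : ((Finset.univ.erase e.2).erase i).card = d - 2 := by
            rw [Finset.card_erase_of_mem hi, Finset.card_erase_of_mem (Finset.mem_univ _), Finset.card_univ, Fintype.card_fin]
            omega
          rw [hfirst, Finset.sum_congr rfl hrest, Finset.sum_const, nsmul_eq_mul, hcard, if_neg hμ]
          have h1 := hG1 K
          have h2 := hG2 K
          have hGK := hG0 K
          nlinarith

/-- **THE AXIS SUPERSOLUTION INEQUALITY FOR THE TORUS INFLUENCE COUNT.**  With the data of `sum_profile_plaqsThrough_le` and `u = G ∘ H_i`:
`∑_{y ∈ T} tInfluence e y · u(y) ≤ P(e) · u(e)` for every finite link set `T`. [folklore] -/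
theorem sum_tInfluence_mul_le_axis (hd : 2 ≤ d) (hL : 2 ≤ L) {θ : ℝ} {G : ZMod (2 * L) → ℝ} (hG0 : ∀ k, 0 ≤ G k)
    (hG1 : ∀ k, G (k + 1) + G (k - 1) ≤ (θ + θ⁻¹) * G k) (hG2 : ∀ k, G (k + 2) + G (k - 2) ≤ (θ ^ 2 + θ⁻¹ ^ 2) * G k)
    (e : Edge d L) (i : Fin d) (T : Finset (Edge d L)) :
    ∑ y ∈ T, (tInfluence e y : ℝ) * G (((2 * (y.1 i).val : ℕ) : ZMod (2 * L)) + (if y.2 = i then 1 else 0)) ≤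
      (if e.2 = i then 2 * ((d - 1 : ℕ) : ℝ) * (θ + θ⁻¹ + 1)
        else θ⁻¹ ^ 2 + 2 * θ⁻¹ + 2 * θ + θ ^ 2 + 6 * ((d - 2 : ℕ) : ℝ)) *
        G (((2 * (e.1 i).val : ℕ) : ZMod (2 * L)) + (if e.2 = i then 1 else 0)) := by
  classical
  set u : Edge d L → ℝ := fun y => G (((2 * (y.1 i).val : ℕ) : ZMod (2 * L)) + (if y.2 = i then 1 else 0)) with hu
  have hu0 : ∀ y, 0 ≤ u y := fun y => hG0 _
  have h1 : ∑ y ∈ T, (tInfluence e y : ℝ) * u y ≤ ∑ q ∈ plaqsThrough e, ∑ k : Fin 3, u (tstapleLinks q e k) := by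
    unfold tInfluence
    push_cast
    simp only [Finset.sum_mul]
    rw [Finset.sum_comm]
    refine Finset.sum_le_sum fun q _ => ?_
    rw [Finset.sum_comm]
    refine Finset.sum_le_sum fun k _ => ?_
    rw [show ∑ y ∈ T, (if tstapleLinks q e k = y then (1 : ℝ) else 0) * u y =
      ∑ y ∈ T, (if tstapleLinks q e k = y then u y else 0) from Finset.sum_congr rfl fun y _ => by split_ifs <;> simp,
      Finset.sum_ite_eq]
    split_ifs
    · exact le_rfl
    · exact hu0 _
  exact h1.trans (sum_profile_plaqsThrough_le hd hL hG0 hG1 hG2 e i)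

end Summit.Ventures.YMGap.RobustBall.TorusAxis

end
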